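import Summits.ResolutionOfSingularities.ResolutionOfSingularities.Theses.RuledResidues
import Summits.ResolutionOfSingularities.ResolutionOfSingularities.Theorems.RuledResiduesNonRuledDivisorsStubTransportPlace
import Summits.ResolutionOfSingularities.ResolutionOfSingularities.Theorems.RuledResiduesNonRuledDivisorsStubTransportSingular
import Summits.ResolutionOfSingularities.ResolutionOfSingularities.Theorems.RuledResiduesNonRuledDivisorsStubTransportNonRuled
import Summits.ResolutionOfSingularities.ResolutionOfSingularities.Theorems.RuledResiduesNonRuledDivisorsStubTransportLocal
import Summits.ResolutionOfSingularities.ResolutionOfSingularities.Theorems.RuledResiduesNonRuledDivisorsStubEscapeInjective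

/-!
# Line `contracted-divisor` for crux `RuledResidues.NonRuledDivisors` (stmt-ResolutionOfSingularities-18075)

LEAD c2 skeleton (owned copy, continuation of lead c1 of `Cruxes/NonRuledDivisors/Lines/contracted_divisor.lean`): the two true stubs
are replaced by their landed Theorems; ONE sorry remains — the hunt `stub_contractedDivisorGerm`.

Strategist line (gen 1), registered ALONGSIDE the lead's line `automorphism-orbit`; it reuses the
landed transport theorems of that line (`Theorems.transportPlace_*`, `Theorems.stub_transportSingular`,
`Theorems.stub_transportNonRuled`) and differs in the HUNT OBJECT and in the INJECTIVITY ENGINE.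

HUNT (`stub_contractedDivisorGerm`, the only open stub once stubs 2–3 land): an affine model `R`
(f.g. `k`-subalgebra of `K`, `char k = p`, `Frac R = K`), a prime `P` with `R_P` non-regular, a ring
automorphism `τ` of `K`, semilinear over an automorphism `ι` of `k`, inducing a LOCAL endomorphism
of `R_P` — typed as: every `r ∈ R` has `τ r = a/s` with `a, s ∈ R`, `s ∉ P`, and `r ∈ P ↔ a ∈ P`
(so `τ R ⊆ R_P`, `τ P ⊆ P R_P`, `τ (R∖P) ⊆ R_Pˣ`; `τ R ⊆ R` is NOT required and `τ` need NOT map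
`R_P` onto itself) — and ONE discrete valuation ring `D` of `K`, essentially of finite type over
`k`, with NON-RULED residue field, containing `R_P` (`R ⊆ D`, `R∖P ⊆ Dˣ`), whose centre on `R` is
STRICTLY inside `P` (some `s ∈ P` is a unit of `D`) and which is CONTRACTED INTO `P` by `τ`
(`τ P ⊆ 𝔪_D`).  Geometrically: a birational self-map `φ = Spec τ` of `X = Spec R`, regular at the
singular point `P = φ(P)`, contracting a non-ruled prime divisor `D ∋ P` of `X` into `P`;
equivalently the germ `(X,P)` reappears, by an exact `k`-isomorphism of local rings, at a point `Q`
of a modification `X' → X` lying on a non-ruled exceptional divisor over `P`.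

ENGINE (stubs 2–3, true): the orbit `n ↦ D.comap τⁿ⁺¹` consists of members of the crux's witness
set (`stub_transportLocal` + the landed singular-centre and non-ruled transports), and `n ↦ D.comap τⁿ`
is injective by the ESCAPING UNIT (`stub_escapeInjective`): if `D.comap τᵈ = D` with `d ≥ 1`, the
unit `s ∈ P ∩ Dˣ` would satisfy `τᵈ s ∈ τ(P R_P) ⊆ 𝔪_D`, hence `s ∈ 𝔪_D` — contradiction.  Neither
`τ P ⊆ P²` (engine A) nor a constants twist (engine B) is needed: the family-of-cones tower
`z^p = G(x') + x₁^j M(x')`, `σ = (x₁, x₁x', x₁^{m+1}z)`, has `σ x₁ = x₁`, `σ` `k`-linear, and is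
certified by C (escaping unit `x'_i/x₁`) though by neither A nor B.
-/

-- dupNamespace: the problem namespace legitimately repeats the summit name
set_option linter.dupNamespace false
set_option linter.unusedVariables false

namespace Summit.ResolutionOfSingularities.ResolutionOfSingularities.Cruxes.NonRuledDivisors.ContractedDivisor

open Summit.ResolutionOfSingularities.ResolutionOfSingularities.Theses.RuledResidues
open Summit.ResolutionOfSingularities.ResolutionOfSingularities.Theorems

/-- Stub 1 (THE HUNT, L): a CONTRACTED-DIVISOR GERM — affine model `R`, singular prime `P`, a ring automorphism `τ` of `K` semilinear over `ι : k ≃+* k` inducing a local endomorphism of `R_P` (`τ r = a/s`, `s ∉ P`, `r ∈ P ↔ a ∈ P`), and one DVR `D ⊇ R_P` of `K`, essentially of finite type over `k`, with non-ruled residue field, centred strictly inside `P` (`∃ s ∈ P ∩ Dˣ`) and contracted into `P` by `τ` (`τ P ⊆ 𝔪_D`). -/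
theorem stub_contractedDivisorGerm : ∃ p : ℕ, p.Prime ∧ ∃ (k K : Type) (_ : Field k) (_ : CharP k p) (_ : Field K) (_ : Algebra k K), ∃ R : Subalgebra k K, R.FG ∧ IsFractionRing R K ∧ ∃ (P : Ideal R.toSubring) (_ : P.IsPrime), ¬ IsRegularLocalRing (Localization.AtPrime P) ∧ ∃ (τ : K ≃+* K) (ι : k ≃+* k), (∀ c : k, τ (algebraMap k K c) = algebraMap k K (ι c)) ∧ (∀ r : R.toSubring, ∃ a s : R.toSubring, s ∉ P ∧ τ (r : K) * (s : K) = (a : K) ∧ (r ∈ P ↔ a ∈ P)) ∧ ∃ (D : ValuationSubring K) (hkD : ∀ c : k, algebraMap k K c ∈ D), IsDiscreteValuationRing D ∧ (∃ B : Subalgebra k K, B.FG ∧ B.toSubring ≤ D.toSubring ∧ ∀ x : K, x ∈ D → ∃ b s : K, b ∈ B ∧ s ∈ B ∧ s ∉ D.nonunits ∧ x * s = b) ∧ R.toSubring ≤ D.toSubring ∧ (∀ s : R.toSubring, s ∉ P → (s : K) ∉ D.nonunits) ∧ (∀ r : R.toSubring, r ∈ P → τ (r : K) ∈ D.nonunits)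 ∧ (∃ s : R.toSubring, s ∈ P ∧ (s : K) ∉ D.nonunits) ∧ ¬ (∃ (L : Subfield (IsLocalRing.ResidueField D)) (t : IsLocalRing.ResidueField D), (∀ c : k, IsLocalRing.residue D ⟨algebraMap k K c, hkD c⟩ ∈ L) ∧ (∀ f : Polynomial L, f ≠ 0 → Polynomial.eval₂ L.subtype t f ≠ 0) ∧ (∀ x : IsLocalRing.ResidueField D, ∃ f g : Polynomial L, Polynomial.eval₂ L.subtype t g ≠ 0 ∧ x * Polynomial.eval₂ L.subtype t g = Polynomial.eval₂ L.subtype t f)) := by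
  sorry

/-! Stubs 2–3 of the registered line are LANDED and used by name below:
`Theorems.stub_transportLocal` (p170707) and `Theorems.stub_escapeInjective` (p170705). -/

/-- COMPOSITION (kernel-checked, no `sorry`): the three stubs imply the crux BY NAME.  The members are
`W_n = D.comap τⁿ⁺¹` (`n : ℕ`); the invariant "contains `k` and `R_P`, DVR, essentially of finite
type, `τ P ⊆ 𝔪`, non-ruled" is carried along the orbit by stub 2 and the landed
`Theorems.stub_transportNonRuled`; from index `1` on the members dominate `P`, so their centre is
singular by the landed `Theorems.stub_transportSingular`; injectivity is stub 3 shifted by one. -/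
theorem NonRuledDivisors_of : NonRuledDivisors := by
  obtain ⟨p, hp, k, K, instk, instc, instK, instA, R, hRfg, hfrac, P, instP, hsing, τ, ι, hsemi,
    hloc, D, hkD, hdvr, hft, hle, hunit, hcon, hesc, hnr⟩ := stub_contractedDivisorGerm
  refine ⟨p, hp, k, K, instk, instc, instK, instA, R, hRfg, hfrac, ?_⟩
  -- the orbit of `D` under `W ↦ W.comap τ`
  let f : ℕ → ValuationSubring K := fun n => D.comap ((τ ^ n : K ≃+* K) : K →+* K)
  have hf0 : f 0 = D := by
    ext x
    simp only [f, ValuationSubring.mem_comap]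
    rfl
  have hfsucc : ∀ n : ℕ, f (n + 1) = (f n).comap (τ : K →+* K) := by
    intro n
    ext x
    simp only [f, ValuationSubring.mem_comap, pow_succ]
    rfl
  -- the invariant carried along the orbit
  have hall : ∀ n : ℕ, ∃ hk : (∀ c : k, algebraMap k K c ∈ f n),
      IsDiscreteValuationRing (f n) ∧
      (∃ B : Subalgebra k K, B.FG ∧ B.toSubring ≤ (f n).toSubring ∧
        ∀ x : K, x ∈ f n → ∃ b s : K, b ∈ B ∧ s ∈ B ∧ s ∉ (f n).nonunits ∧ x * s = b) ∧
      R.toSubring ≤ (f n).toSubring ∧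
      (∀ s : R.toSubring, s ∉ P → (s : K) ∉ (f n).nonunits) ∧
      (∀ r : R.toSubring, r ∈ P → τ (r : K) ∈ (f n).nonunits) ∧
      ¬ (∃ (L : Subfield (IsLocalRing.ResidueField (f n))) (t : IsLocalRing.ResidueField (f n)),
          (∀ c : k, IsLocalRing.residue (f n) ⟨algebraMap k K c, hk c⟩ ∈ L) ∧
          (∀ g : Polynomial L, g ≠ 0 → Polynomial.eval₂ L.subtype t g ≠ 0) ∧
          (∀ x : IsLocalRing.ResidueField (f n), ∃ g h : Polynomial L,
            Polynomial.eval₂ L.subtype t h ≠ 0 ∧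
              x * Polynomial.eval₂ L.subtype t h = Polynomial.eval₂ L.subtype t g)) := by
    intro n
    induction n with
    | zero =>
      rw [hf0]
      exact ⟨hkD, hdvr, hft, hle, hunit, hcon, hnr⟩
    | succ n ih =>
      obtain ⟨hk, hdvr', hft', hle', hunit', hcon', hnr'⟩ := ih
      obtain ⟨hk'', hdvr'', hft'', hle'', hunit'', -, hcon''⟩ :=
        Theorems.stub_transportLocal k K R P τ ι hsemi hloc (f n) (f (n + 1)) (hfsucc n) hk hdvr' hft' hle'
          hunit' hcon'
      exact ⟨hk'', hdvr'', hft'', hle'', hunit'', hcon'',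
        Theorems.stub_transportNonRuled k K τ ι hsemi (f n) (f (n + 1)) (hfsucc n) hk hk'' hnr'⟩
  -- from index 1 on, the members lie in the witness set of the crux
  have hmem : ∀ n : ℕ, ∃ hk : (∀ c : k, algebraMap k K c ∈ f (n + 1)),
      IsDiscreteValuationRing (f (n + 1)) ∧
      (∃ B : Subalgebra k K, B.FG ∧ B.toSubring ≤ (f (n + 1)).toSubring ∧
        ∀ x : K, x ∈ f (n + 1) → ∃ b s : K, b ∈ B ∧ s ∈ B ∧ s ∉ (f (n + 1)).nonunits ∧ x * s = b) ∧
      (∃ h : R.toSubring ≤ (f (n + 1)).toSubring, ¬ IsRegularLocalRing (Localization.AtPrime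
        (Ideal.comap (Subring.inclusion h) (IsLocalRing.maximalIdeal (f (n + 1)))))) ∧
      ¬ (∃ (L : Subfield (IsLocalRing.ResidueField (f (n + 1))))
          (t : IsLocalRing.ResidueField (f (n + 1))),
          (∀ c : k, IsLocalRing.residue (f (n + 1)) ⟨algebraMap k K c, hk c⟩ ∈ L) ∧
          (∀ g : Polynomial L, g ≠ 0 → Polynomial.eval₂ L.subtype t g ≠ 0) ∧
          (∀ x : IsLocalRing.ResidueField (f (n + 1)), ∃ g h : Polynomial L,
            Polynomial.eval₂ L.subtype t h ≠ 0 ∧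
              x * Polynomial.eval₂ L.subtype t h = Polynomial.eval₂ L.subtype t g)) := by
    intro n
    obtain ⟨hk, hdvr', hft', hle', hunit', hcon', hnr'⟩ := hall n
    obtain ⟨-, -, -, hle'', -, hdom'', -⟩ :=
      Theorems.stub_transportLocal k K R P τ ι hsemi hloc (f n) (f (n + 1)) (hfsucc n) hk hdvr' hft' hle'
        hunit' hcon'
    obtain ⟨hk₁, hdvr₁, hft₁, -, -, -, hnr₁⟩ := hall (n + 1)
    haveI := instP
    exact ⟨hk₁, hdvr₁, hft₁,
      ⟨hle'', Theorems.stub_transportSingular K R.toSubring P hsing (f (n + 1)) hle'' hdom''⟩, hnr₁⟩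
  -- injectivity of the shifted orbit
  haveI := instP
  have hinj : Function.Injective f :=
    Theorems.stub_escapeInjective K R.toSubring P τ hloc D hle hunit hcon hesc
  have hinj' : Function.Injective (fun n : ℕ => f (n + 1)) :=
    fun m n h => Nat.succ_injective (hinj h)
  exact Set.infinite_of_injective_forall_mem hinj' hmem

end Summit.ResolutionOfSingularities.ResolutionOfSingularities.Cruxes.NonRuledDivisors.ContractedDivisor
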